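import Literature.NumberTheory.EllipticCurves.DivisionPointsOnLocalCurve
import Literature.NumberTheory.EllipticCurves.FormalGroupLubinTateDivisionPointsDegreeOne
import HarnessLib

/-!
# Division points with algebraic coordinates ON THE LANE CURVE `curveOver M (V ⊗ LTCoeff F)`: nonsingularity, the group law
# `ξ(w) − ξ(u) = ξ(q)` and orders, transported `ℂ → K̄ → F̄ → M → lane curve` (de Shalit II.4.4 / II.4.9 bookkeeping — proofs only)

Topic `NumberTheory/EllipticCurves` (theorems only; no definition, no named fact, no instance).  Cell `bsd-print-cf2`, width seat
`bsd-line-cf2c-w4` g15, brick B10c of the memo `ALPHA-ASSEMBLY-w4g15.md`: the hypotheses (he′) «`(x,y)(τ^{m+1}P₀) − U_m = (x,y)(ξ(Ω/π₀^{m+1}))`»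
and (N2) «`addOrderOf U_m = p^{m+1}`» of `exists_unit_relColemanSeries_eq_subst_subst_of_divisionPoints` (B10b) live on the LANE curve
`curveOver M ((W ⊗ ℤ_p) ⊗_{e⁻¹} LTCoeff F)` over a finite `M ⊆ F̄`; the group law and the orders of the points `ξ(z)` are known over `ℂ`
(`DivisionPointsOnLocalCurve` §1, `DeShalitDivisionPointsLattice` §4).  This file is the transport, for a "global" field `K♭` read in `ℂ`
by `ι̂` and in `F̄` by `ι_v`, of points whose `M`-coordinates `X` satisfy `(X : F̄) = ι_v x♭`, `ι̂ x♭ = x(ξ z)` (model coordinates):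

* `curveOver_map_map_eq_baseChange` — the lane curve IS `W ⊗ M` (`curveOver_map_map_intCast` + `baseChange_eq_map_intCastRingHom`);
* ★ `nonsingular_curveOver_of_readings` — `(X, Y)` is a nonsingular point of the lane curve;
* ★★ `some_sub_some_eq_some_curveOver_of_readings` — **`ξ(w) − ξ(u) = ξ(q)` on the lane curve** for `q + u = w` (`q, u, w ∉ Λ`) — (he′) with
  `w = β^{m+1}Ω`, `u = u_{m+1}`, `q = Ω/π₀^{m+1}`;
* ★★ `addOrderOf_some_curveOver_of_readings` — **`addOrderOf ξ(u) = addOrderOf (toPoint u)`** on the lane curve (so `= 2^{m+1}` for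
  `u = u_{m+1}` by `addOrderOf_toPoint_divisionPt_succ`) — (N2).
The `DecidableEq` instances behind Mathlib's group law differ between the generic transport lemmas and the lane's intermediate fields;
the statements here are elaborated on the lane side and bridged with `convert` (the instances are subsingletons).

No summit statement is proved; BSD is not proved by any of this.

## References
* [deShalit1987] E. de Shalit, *Iwasawa theory of elliptic curves with complex multiplication* (1987), II §1.5 (15), II §4.4 Definition, (iv), II §4.9 (ii).
* [SilvermanAEC2009] J. H. Silverman, *The Arithmetic of Elliptic Curves*, 2nd ed. (2009), Prop. VI.3.6 (b), III.2.3, VII.1.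
-/

noncomputable section

open scoped Classical PeriodPair
open PowerSeries

namespace Literature.NumberTheory.EllipticCurves

open ValuativeRel Literature.NumberTheory.GaloisRepresentations
  Literature.NumberTheory.GaloisRepresentations.IsNonarchimedeanLocalField
  Literature.NumberTheory.GaloisRepresentations.LubinTate
open Literature.NumberTheory.EllipticCurves.FormalGroupChart _root_.WeierstrassCurve

section LaneCurve

variable {F : Type} [Field F] [ValuativeRel F] [TopologicalSpace F] [IsNonarchimedeanLocalField F]

attribute [local instance] ltNormUniformSpace ltNormIsUniformAddGroup rk1 nF nE fintypeResidueField

variable {p : ℕ} [Fact p.Prime] (e : 𝒪[F] ≃+* ℤ_[p]) (M : IntermediateField F (AlgebraicClosure F)) [FiniteDimensional F M]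
  (W : WeierstrassCurve ℤ)

/-- **The lane curve is `W ⊗ M`**: `curveOver M ((W ⊗ ℤ_p) ⊗_{e⁻¹} LTCoeff F) = W.baseChange M`.
[cite: SilvermanAEC2009, VII.1] -/
theorem curveOver_map_map_eq_baseChange :
    curveOver M ((W.map (Int.castRingHom ℤ_[p])).map ((LTCoeff.of F).toRingHom.comp e.symm.toRingHom)) = W.baseChange M :=
  (curveOver_map_map_intCast e M W).trans (baseChange_eq_map_intCastRingHom W M).symm

variable {Kb : Type*} [Field Kb] (ιc : Kb →+* ℂ) (ιv : Kb →+* AlgebraicClosure F) (L : PeriodPair)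
  (h₂ : L.g₂ = (W.baseChange ℂ).c₄ / 12) (h₃ : L.g₃ = (W.baseChange ℂ).c₆ / 216)

include h₂ h₃ in
/-- ★ **A division point with algebraic coordinates is a nonsingular point of the lane curve**: for `z ∉ Λ`, `x♭, y♭ ∈ K♭` with
`ι̂ x♭ = ℘(z) − b₂/12`, `ι̂ y♭ = (℘′(z) − a₁(℘(z) − b₂/12) − a₃)/2` and `X, Y ∈ M` reading them (`(X : F̄) = ι_v x♭`), `(X, Y)` is nonsingular
on `curveOver M ((W ⊗ ℤ_p) ⊗ LTCoeff F)`. [cite: deShalit1987, II §1.5 (15)] [cite: SilvermanAEC2009, Prop. VI.3.6 (b), VII.1] -/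
theorem nonsingular_curveOver_of_readings {z : ℂ} (hz : z ∉ L.lattice) {xb yb : Kb}
    (hx : ιc xb = ℘[L] z - (W.baseChange ℂ).b₂ / 12)
    (hy : ιc yb = (℘'[L] z - (W.baseChange ℂ).a₁ * (℘[L] z - (W.baseChange ℂ).b₂ / 12) - (W.baseChange ℂ).a₃) / 2)
    {X Y : M} (hX : ((X : M) : AlgebraicClosure F) = ιv xb) (hY : ((Y : M) : AlgebraicClosure F) = ιv yb) :
    (curveOver M ((W.map (Int.castRingHom ℤ_[p])).map ((LTCoeff.of F).toRingHom.comp e.symm.toRingHom))).toAffine.Nonsingular X Y := by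
  rw [curveOver_map_map_eq_baseChange e M W]
  have h1 := nonsingular_of_map_eq_model W L ιc h₂ h₃ hz hx hy
  have h2 := (nonsingular_baseChange_map_iff W ιv xb yb).mpr h1
  rw [← hX, ← hY] at h2
  exact (nonsingular_baseChange_map_iff W (algebraMap M (AlgebraicClosure F)) X Y).mp h2

include h₂ h₃ in
/-- ★★ **`ξ(w) − ξ(u) = ξ(q)` on the lane curve** for `q + u = w`, `q, u, w ∉ Λ`, the three points given by `M`-coordinates reading global
coordinates reading the model coordinates of `ξ(q)`, `ξ(u)`, `ξ(w)` — the chart hypothesis (he′) of the bridge with `w = β^{m+1}Ω`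
(`τ^{m+1}P₀`), `u = u_{m+1}`, `q = Ω/π₀^{m+1}`. [cite: deShalit1987, II §4.4 Definition, II §4.9 (ii)] [cite: SilvermanAEC2009, Prop. VI.3.6 (b), III.2.3] -/
theorem some_sub_some_eq_some_curveOver_of_readings {dec : DecidableEq M} {q u w : ℂ} (hq : q ∉ L.lattice) (hu : u ∉ L.lattice) (hw : w ∉ L.lattice)
    (hquw : q + u = w) {xq yq xu yu xw yw : Kb}
    (hxq : ιc xq = ℘[L] q - (W.baseChange ℂ).b₂ / 12)
    (hyq : ιc yq = (℘'[L] q - (W.baseChange ℂ).a₁ * (℘[L] q - (W.baseChange ℂ).b₂ / 12) - (W.baseChange ℂ).a₃) / 2)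
    (hxu : ιc xu = ℘[L] u - (W.baseChange ℂ).b₂ / 12)
    (hyu : ιc yu = (℘'[L] u - (W.baseChange ℂ).a₁ * (℘[L] u - (W.baseChange ℂ).b₂ / 12) - (W.baseChange ℂ).a₃) / 2)
    (hxw : ιc xw = ℘[L] w - (W.baseChange ℂ).b₂ / 12)
    (hyw : ιc yw = (℘'[L] w - (W.baseChange ℂ).a₁ * (℘[L] w - (W.baseChange ℂ).b₂ / 12) - (W.baseChange ℂ).a₃) / 2)
    {Xq Yq Xu Yu Xw Yw : M}
    (hXq : ((Xq : M) : AlgebraicClosure F) = ιv xq) (hYq : ((Yq : M) : AlgebraicClosure F) = ιv yq)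
    (hXu : ((Xu : M) : AlgebraicClosure F) = ιv xu) (hYu : ((Yu : M) : AlgebraicClosure F) = ιv yu)
    (hXw : ((Xw : M) : AlgebraicClosure F) = ιv xw) (hYw : ((Yw : M) : AlgebraicClosure F) = ιv yw)
    (hnq : (curveOver M ((W.map (Int.castRingHom ℤ_[p])).map ((LTCoeff.of F).toRingHom.comp e.symm.toRingHom))).toAffine.Nonsingular Xq Yq)
    (hnu : (curveOver M ((W.map (Int.castRingHom ℤ_[p])).map ((LTCoeff.of F).toRingHom.comp e.symm.toRingHom))).toAffine.Nonsingular Xu Yu)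
    (hnw : (curveOver M ((W.map (Int.castRingHom ℤ_[p])).map ((LTCoeff.of F).toRingHom.comp e.symm.toRingHom))).toAffine.Nonsingular Xw Yw) :
    (.some Xw Yw hnw : (curveOver M ((W.map (Int.castRingHom ℤ_[p])).map
        ((LTCoeff.of F).toRingHom.comp e.symm.toRingHom))).toAffine.Point) - .some Xu Yu hnu = .some Xq Yq hnq := by
  -- over `K♭` (read in `ℂ`), then `F̄`
  have hw' : q + u ∉ L.lattice := hquw ▸ hw
  have hq1 := nonsingular_of_map_eq_model W L ιc h₂ h₃ hq hxq hyq
  have hu1 := nonsingular_of_map_eq_model W L ιc h₂ h₃ hu hxu hyu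
  have hw1 := nonsingular_of_map_eq_model W L ιc h₂ h₃ hw hxw hyw
  have k1 : (.some xq yq hq1 : (W.baseChange Kb).toAffine.Point) + .some xu yu hu1 = .some xw yw hw1 :=
    some_add_some_eq_some_of_map_eq_model W L ιc h₂ h₃ hq hu hw' hxq hyq hxu hyu (by rw [hxw, hquw]) (by rw [hyw, hquw]) hq1 hu1 hw1
  have hq1' := (nonsingular_baseChange_map_iff W ιv xq yq).mpr hq1
  have hu1' := (nonsingular_baseChange_map_iff W ιv xu yu).mpr hu1
  have hw1' := (nonsingular_baseChange_map_iff W ιv xw yw).mpr hw1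
  have k2 := (some_add_some_eq_some_iff_map W ιv hq1 hu1 hw1 hq1' hu1' hw1').mpr k1
  -- on `W ⊗ M` (reflect along `M ⊆ F̄`)
  have hC := curveOver_map_map_eq_baseChange e M W
  have hqM : (W.baseChange M).toAffine.Nonsingular Xq Yq := hC ▸ hnq
  have huM : (W.baseChange M).toAffine.Nonsingular Xu Yu := hC ▸ hnu
  have hwM : (W.baseChange M).toAffine.Nonsingular Xw Yw := hC ▸ hnw
  have hq2 := (nonsingular_baseChange_map_iff W (algebraMap M (AlgebraicClosure F)) Xq Yq).mpr hqM
  have hu2 := (nonsingular_baseChange_map_iff W (algebraMap M (AlgebraicClosure F)) Xu Yu).mpr huM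
  have hw2 := (nonsingular_baseChange_map_iff W (algebraMap M (AlgebraicClosure F)) Xw Yw).mpr hwM
  have eq_q : (.some _ _ hq2 : (W.baseChange (AlgebraicClosure F)).toAffine.Point) = .some _ _ hq1' := by
    simp only [show algebraMap M (AlgebraicClosure F) Xq = ιv xq from hXq, show algebraMap M (AlgebraicClosure F) Yq = ιv yq from hYq]
  have eq_u : (.some _ _ hu2 : (W.baseChange (AlgebraicClosure F)).toAffine.Point) = .some _ _ hu1' := by
    simp only [show algebraMap M (AlgebraicClosure F) Xu = ιv xu from hXu, show algebraMap M (AlgebraicClosure F) Yu = ιv yu from hYu]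
  have eq_w : (.some _ _ hw2 : (W.baseChange (AlgebraicClosure F)).toAffine.Point) = .some _ _ hw1' := by
    simp only [show algebraMap M (AlgebraicClosure F) Xw = ιv xw from hXw, show algebraMap M (AlgebraicClosure F) Yw = ιv yw from hYw]
  have k2' : (.some _ _ hq2 : (W.baseChange (AlgebraicClosure F)).toAffine.Point) + .some _ _ hu2 = .some _ _ hw2 := by
    rw [eq_q, eq_u, eq_w]; exact k2
  have k3 := (some_add_some_eq_some_iff_map W (algebraMap M (AlgebraicClosure F)) hqM huM hwM hq2 hu2 hw2).mp k2'
  -- on the lane curve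
  rw [sub_eq_iff_eq_add]
  revert hnq hnu hnw
  rw [hC]
  intro hnq hnu hnw
  obtain rfl : dec = fun a b => Classical.propDecidable (a = b) := Subsingleton.elim _ _
  exact k3.symm

include h₂ h₃ in
/-- ★★ **The order of a division point on the lane curve is the order of its argument in `ℂ/Λ`**:
`addOrderOf (X, Y) = addOrderOf (toPoint u)` — with `u = u_{m+1}` and `addOrderOf_toPoint_divisionPt_succ` this is (N2)
`addOrderOf U_m = 2^{m+1}`. [cite: deShalit1987, II §4.4 (iv)] [cite: SilvermanAEC2009, Prop. VI.3.6 (b), III.2.3] -/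
theorem addOrderOf_some_curveOver_of_readings {dec : DecidableEq M} {u : ℂ} (hu : u ∉ L.lattice) {xu yu : Kb}
    (hxu : ιc xu = ℘[L] u - (W.baseChange ℂ).b₂ / 12)
    (hyu : ιc yu = (℘'[L] u - (W.baseChange ℂ).a₁ * (℘[L] u - (W.baseChange ℂ).b₂ / 12) - (W.baseChange ℂ).a₃) / 2)
    {Xu Yu : M} (hXu : ((Xu : M) : AlgebraicClosure F) = ιv xu) (hYu : ((Yu : M) : AlgebraicClosure F) = ιv yu)
    (hnu : (curveOver M ((W.map (Int.castRingHom ℤ_[p])).map ((LTCoeff.of F).toRingHom.comp e.symm.toRingHom))).toAffine.Nonsingular Xu Yu) :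
    addOrderOf (.some Xu Yu hnu : (curveOver M ((W.map (Int.castRingHom ℤ_[p])).map
        ((LTCoeff.of F).toRingHom.comp e.symm.toRingHom))).toAffine.Point) = addOrderOf (L.toPoint u) := by
  have hu1 := nonsingular_of_map_eq_model W L ιc h₂ h₃ hu hxu hyu
  have k1 := addOrderOf_some_of_map_eq_model W L ιc h₂ h₃ hu hxu hyu hu1
  have hu1' := (nonsingular_baseChange_map_iff W ιv xu yu).mpr hu1
  have k2 := addOrderOf_some_map_eq W ιv hu1 hu1'
  have hC := curveOver_map_map_eq_baseChange e M W
  have huM : (W.baseChange M).toAffine.Nonsingular Xu Yu := hC ▸ hnu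
  have hu2 := (nonsingular_baseChange_map_iff W (algebraMap M (AlgebraicClosure F)) Xu Yu).mpr huM
  have eq_u : (.some _ _ hu2 : (W.baseChange (AlgebraicClosure F)).toAffine.Point) = .some _ _ hu1' := by
    simp only [show algebraMap M (AlgebraicClosure F) Xu = ιv xu from hXu, show algebraMap M (AlgebraicClosure F) Yu = ιv yu from hYu]
  have k3 := addOrderOf_some_map_eq W (algebraMap M (AlgebraicClosure F)) huM hu2
  have k4 := k3.symm.trans (((congrArg addOrderOf eq_u).trans k2).trans k1)
  revert hnu
  rw [hC]
  intro hnu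
  obtain rfl : dec = fun a b => Classical.propDecidable (a = b) := Subsingleton.elim _ _
  exact k4

end LaneCurve

/-! ## Appended (g15): the lane curve is elliptic at every level -/

section Elliptic

variable {F : Type} [Field F] [ValuativeRel F] [TopologicalSpace F] [IsNonarchimedeanLocalField F]

attribute [local instance] ltNormUniformSpace ltNormIsUniformAddGroup rk1 nF nE fintypeResidueField

variable {p : ℕ} [Fact p.Prime] (e : 𝒪[F] ≃+* ℤ_[p]) (M : IntermediateField F (AlgebraicClosure F)) [FiniteDimensional F M]
  (W : WeierstrassCurve ℤ)

/-- **The lane curve `W ⊗ M` is elliptic** for an integer model with `Δ(W) ≠ 0`: `𝒪_F ≃ ℤ_p` forces characteristic `0`, so `Δ ≠ 0` in `M`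
— the instance hypothesis `[∀ m, (curveOver (E·F_π^{m+1}) V).IsElliptic]` of the bridge, levelwise. [cite: SilvermanAEC2009, III.1, VII.1] -/
theorem isElliptic_curveOver_map_map (hΔ : W.Δ ≠ 0) :
    (curveOver M ((W.map (Int.castRingHom ℤ_[p])).map ((LTCoeff.of F).toRingHom.comp e.symm.toRingHom))).IsElliptic := by
  haveI : CharZero 𝒪[F] := e.toRingHom.charZero
  haveI : CharZero F := charZero_of_injective_algebraMap (R := 𝒪[F]) (A := F) Subtype.val_injective
  haveI : CharZero (AlgebraicClosure F) := charZero_of_injective_algebraMap (algebraMap F (AlgebraicClosure F)).injective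
  rw [curveOver_map_map_eq_baseChange e M W]
  refine ⟨?_⟩
  rw [WeierstrassCurve.baseChange, WeierstrassCurve.map_Δ, isUnit_iff_ne_zero, eq_intCast, Int.cast_ne_zero]
  exact hΔ

end Elliptic

end Literature.NumberTheory.EllipticCurves

end
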